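import Summits.QuantumFields.BalabanUV.Beta.GAN24.RelInvWardPairing
import Summits.QuantumFields.BalabanUV.Beta.GAN24.EdgePlaquettePotential
import Summits.QuantumFields.BalabanUV.Beta.KernelWardMColumn
import Summits.QuantumFields.BalabanUV.Beta.GAN24.MultiplierZeroMass
import Summits.QuantumFields.BalabanUV.Beta.GAN24.CoDressedColumnPairing

/-!
# `BalabanUV.Beta.GAN24.EdgePotentialColumnOrthogonal` — binder row G-an2-4 ∕ (CONV-C), the (S) row of RULING R-gan24p1-g27-1 B (viii), the Ward-type half (W-γ) (road-P2 g39),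
# EXIT class, jb = 0: **A BOUNDED `L`-PERIODIC 1-FORM IS `(d*d)`-ORTHOGONAL TO EVERY ℋ-COLUMN OF THE CO-DRESSED ONE-STEP RESOLVENT — IN PARTICULAR THE EDGE POTENTIAL `m̃_ab`**
# (G-an2-4 formalisation swarm → CRUX TEAM (2), seat `b2b-balaban-gan24-formalise-leaf-06` = the (γ) hand, gen 46, INTENT 3; the (α⁺)-side mechanism (M2) of ENGINE E-leaf06-g46-1)

NOT IN PRINT; OUR BOOKKEEPING ([folklore] BY NAME over: leaf-06 g46's `RelInvWardPairing.ward_pairing` (an2 gen 13's `RelInv` rule 4 + `comp_bhK_inl`) and `EdgePlaquettePotential`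
(`curvAdj_curv_sub_dz`, the edge potential's bound and periodicity); an5∕an2's rooted axial projector `RootedComb.axProjAt` (`axProjAt_apply`, `AxialDressingRooted.axProjAt_eq_zero_of_isCombBond`,
`treeGaugeAt_shift`), leaf-02 g51's `CoDressedColumnPairing.abs_treeGaugeAt_le`; an1 g27's `KernelWardMColumn.colM_coDressKBmAt` and gan24-leaf-14's `MultiplierZeroMass.tsum_colM_KInvStep_pos`
(the `mm` block has zero column mass); `AffineAveraging.sum_range_dz`; 0 `def`, 0 cited fact, 0 `def … : Prop`, 0 sorry).
HONEST FRAMING (cell contract, verbatim): «discharging `BetaPertH` makes Bałaban's UV stability UNCONDITIONAL — a real constructive-QFT result; it is NOT the continuum limit and NOT the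
Clay problem.»  HONEST DEPENDENCY (verbatim): «continuum YM on T⁴ ⇐ BetaPertH ∧ nine spine estimates (0/9 proved); BetaPertH ⇐ (D1) ∧ (D4) ∧ CAP+tail; G-an2-4 gates asym, D1 and NE2/3/4.»

WHY.  In the exit class, channel `(a,b)`, (W-γ) at a slot `e = (ν, y′)` reads `⟨(d*d) m̃_ab, v_γ(e) + v_{α⁺}(e)⟩ = 0` (INTENT 1); road-P2's (α⁺) read-vector is `(g⁺(e) − g⁺(ℓ))·colH G₀(e)_ℓ`, so its
`g⁺(e)`-part is `g⁺(e)·⟨(d*d) m̃_ab, colH G₀(e)⟩`.  THIS FILE PROVES THAT PAIRING IS ZERO — for every bounded `L`-periodic `m`, every in-block root, every slot (ENGINE E-leaf06-g46-1 (M2): 1.4e-15):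
by `ward_pairing` with `W = idK` it equals `Σ'_y Σ_κ (𝒬_L m′) κ y·G₀ (L•y) (L•y′) (inr κ)(inr ν)` for the hard-axial representative `m′ = Π^ρ m`; `𝒬_L m′ = 𝒬_L m` (the tree gauge of a
periodic form is periodic, its contour sums telescope to `0`) is CONSTANT in `y` (periodicity), and the `mm` column sums of `G₀` vanish.
* §1 (with leaf-02 g51's `CoDressedColumnPairing.abs_treeGaugeAt_le`) `treeGaugeAt_add_zsmul` (periodic `m` ⇒ periodic `λ^ρ_m`), `axProjAt_eq_sub_dz`, `abs_axProjAt_le`,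
  `contourSum_add_coarse` (periodic `m` ⇒ `𝒬_L m κ` constant), `contourSum_dz_eq_zero_of_periodic`, **`contourSum_axProjAt`** (`𝒬_L (Π^ρ m) = 𝒬_L m`).
* §2 **`tsum_curvAdj_curv_mul_inr_col_eq_zero`**: `RelInv G (bhK L) (axEc ρ L)`, `G` spread, zero `mm` column sums ⇒ `Σ'_u Σ_κ (d*d m) κ u·G u (L•y′) (inl κ) (inr ν) = 0` for every bounded
  `L`-periodic `m`.
* §3 `tsum_inr_inr_coDressKBmAt_KInvStep_zero` (the `mm` column sums of `G₀` vanish, BY NAME), **`tsum_curvAdj_curv_mul_colH_eq_zero`** (the instance `G₀ = coDressKBmAt (toSite r) Lc (KInvStep Lc 0)`),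
  **`edgePotential_orthogonal_colH`** (`m = m̃_ab`): `Σ'_u Σ_κ (curvAdj (curv m̃_ab)) κ u·colH G₀ Lc ν y′ κ u = 0` for `a ≠ b`, every in-block root, every slot.
Asserts NO value of any read vector or table; NOTHING of (W-γ) ∕ (T-F) ∕ (INV) ∕ (S) claimed beyond this one pairing; NEVER «G-an2-4 closed» as (CONV-C); NOT D1, NOT `BetaPertH`, NOT continuum,
NOT Clay.  2026-08-22; no existing file touched.
-/

noncomputable section

open Finset
open scoped BigOperators
open Literature.Probability.LatticeModels (TorusSite Torus.proj Torus.proj_apply)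
open Literature.MathematicalPhysics.QuantumFieldTheory
open Literature.MathematicalPhysics.QuantumFieldTheory.Balaban1983to89
open Literature.MathematicalPhysics.QuantumFieldTheory.Balaban1983to89.Beta
open B12Sec2to5 (l1 l1_nonneg)
open ExpKernelCalculus (MKer Decays comp summable_exp_shift summable_exp_shift')
open AffineAveraging (Form0 Form1 Form2 box toSite unitVec unitVec_apply dz curv curvAdj contourSum sum_range_dz)
open AveragingContours (blk grad shift axial)
open AveragingContoursRooted (treeGaugeAt)
open RootedComb (axProjAt axProjAt_apply)
open HessKerSchurResolvent (idK idK_apply comp_idK_right)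
open OneStepResolventKernel (Fib)
open OneStepKernelFamily (KInvStep colH)
open SecondOrderResponse (colM)
open Summit.QuantumFields.BalabanUV.Beta.TameKernelCalculus
open Summit.QuantumFields.BalabanUV.Beta.ChartConjugationRelative (RelInv spr_comp)
open Summit.QuantumFields.BalabanUV.Beta.AxialDressingRooted (IsCombBondAt axEc coDressKBmAt spr_coDressKBmAt one_le_of_neZero axProjAt_eq_zero_of_isCombBond
  treeGaugeAt_shift mem_axial axial_length_le_of_root)
open Summit.QuantumFields.BalabanUV.Beta.BorderedHessian (bhK relInv_coDressKBmAt_KInvStep_zero)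
open Summit.QuantumFields.BalabanUV.Beta.KernelWardMColumn (colM_coDressKBmAt)
open Summit.QuantumFields.BalabanUV.Beta.GAN24.MultiplierZeroMass (tsum_colM_KInvStep_pos)
open Summit.QuantumFields.BalabanUV.Beta.GAN24.RelInvWardPairing (ward_pairing)
open Summit.QuantumFields.BalabanUV.Beta.GAN24.EdgePlaquettePotential (curvAdj_curv_sub_dz abs_edgePotential_le_one edgePotential_add_zsmul)
open Summit.QuantumFields.BalabanUV.Beta.GAN24.CoDressedColumnPairing (abs_treeGaugeAt_le)

namespace Summit.QuantumFields.BalabanUV.Beta.GAN24.EdgePotentialColumnOrthogonal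

variable {d : ℕ}

/-! ## §1 Bounded periodic 1-forms: the hard-axial representative and its block contour sums -/

/-- [folklore] **THE TREE GAUGE OF AN `L`-PERIODIC FORM IS `L`-PERIODIC** (`treeGaugeAt_shift`: the rooted tree integral commutes with coarse translations). -/
theorem treeGaugeAt_add_zsmul {L : ℕ} (hL : 1 ≤ L) (ρ : Fin (d + 1) → ℤ) {m : Form1 (d + 1) ℝ}
    (hper : ∀ κ x v, m κ (x + (L : ℤ) • v) = m κ x) (x v : Fin (d + 1) → ℤ) :
    treeGaugeAt ρ m L (x + (L : ℤ) • v) = treeGaugeAt ρ m L x := by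
  rw [treeGaugeAt_shift ρ hL m x v]
  have e : shift ((L : ℤ) • v) m = m := by
    funext κ z; exact hper κ z v
  rw [e]

/-- [folklore] The rooted axial projector subtracts the exact form of the tree gauge: `Π^ρ m = m − dz λ^ρ_m`. -/
theorem axProjAt_eq_sub_dz (ρ : Fin (d + 1) → ℤ) (L : ℕ) (m : Form1 (d + 1) ℝ) :
    axProjAt ρ L m = fun β z => m β z - dz (treeGaugeAt ρ m L) β z := by
  funext β z
  rw [axProjAt_apply]
  rfl

/-- [folklore] **THE HARD-AXIAL REPRESENTATIVE OF A BOUNDED FORM IS BOUNDED**: `|Π^ρ m| ≤ B + 2(d+1)·L·B`. -/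
theorem abs_axProjAt_le {L : ℕ} (hL : 1 ≤ L) {r : Fin (d + 1) → ℕ} (hr : r ∈ box (d + 1) L) {m : Form1 (d + 1) ℝ} {B : ℝ}
    (hmB : ∀ κ u, |m κ u| ≤ B) (κ : Fin (d + 1)) (u : Fin (d + 1) → ℤ) :
    |axProjAt (toSite r) L m κ u| ≤ B + 2 * ((((d + 1 : ℕ) : ℝ)) * L * B) := by
  rw [axProjAt_apply]
  have h1 := hmB κ u
  have h2 := abs_treeGaugeAt_le hL hr hmB (u + unitVec κ)
  have h3 := abs_treeGaugeAt_le hL hr hmB u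
  have t1 := abs_sub (m κ u) (treeGaugeAt (toSite r) m L (u + unitVec κ) - treeGaugeAt (toSite r) m L u)
  have t2 := abs_sub (treeGaugeAt (toSite r) m L (u + unitVec κ)) (treeGaugeAt (toSite r) m L u)
  linarith

/-- [folklore] **THE BLOCK CONTOUR SUMS OF AN `L`-PERIODIC FORM DO NOT DEPEND ON THE BLOCK**: `𝒬_L m κ (y + v) = 𝒬_L m κ y`. -/
theorem contourSum_add_coarse {L : ℕ} {m : Form1 (d + 1) ℝ} (hper : ∀ κ x v, m κ (x + (L : ℤ) • v) = m κ x)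
    (κ : Fin (d + 1)) (y v : Fin (d + 1) → ℤ) : contourSum L m κ (y + v) = contourSum L m κ y := by
  simp only [AffineAveraging.contourSum]
  refine Finset.sum_congr rfl fun b _ => Finset.sum_congr rfl fun s _ => ?_
  have e : (L : ℤ) • (y + v) + toSite b + (s : ℤ) • unitVec κ = ((L : ℤ) • y + toSite b + (s : ℤ) • unitVec κ) + (L : ℤ) • v := by
    rw [smul_add]; abel
  rw [e, hper]

/-- [folklore] **THE BLOCK CONTOUR SUMS OF THE GRADIENT OF AN `L`-PERIODIC FUNCTION VANISH** (telescoping `sum_range_dz` + periodicity). -/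
theorem contourSum_dz_eq_zero_of_periodic {L : ℕ} {lam : Form0 (d + 1) ℝ} (hper : ∀ x v, lam (x + (L : ℤ) • v) = lam x)
    (κ : Fin (d + 1)) (y : Fin (d + 1) → ℤ) : contourSum L (dz lam) κ y = 0 := by
  simp only [AffineAveraging.contourSum]
  refine Finset.sum_eq_zero fun b _ => ?_
  rw [sum_range_dz]
  have e : (L : ℤ) • y + toSite b + (L : ℤ) • unitVec κ = ((L : ℤ) • y + toSite b) + (L : ℤ) • unitVec κ := rfl
  rw [e, hper, sub_self]

/-- [folklore] `contourSum` is additive in the form (pointwise difference). -/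
theorem contourSum_sub_apply (L : ℕ) (A B : Form1 (d + 1) ℝ) (κ : Fin (d + 1)) (y : Fin (d + 1) → ℤ) :
    contourSum L (fun β z => A β z - B β z) κ y = contourSum L A κ y - contourSum L B κ y := by
  simp only [AffineAveraging.contourSum, Finset.sum_sub_distrib]

/-- NOT IN PRINT; OUR BOOKKEEPING.  **THE BLOCK CONTOUR SUMS DO NOT SEE THE HARD-AXIAL GAUGE CHANGE**: for an `L`-periodic `m`, `𝒬_L (Π^ρ m) = 𝒬_L m` (the tree gauge is periodic, its
gradient telescopes to zero along every straight block contour). -/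
theorem contourSum_axProjAt {L : ℕ} (hL : 1 ≤ L) (ρ : Fin (d + 1) → ℤ) {m : Form1 (d + 1) ℝ} (hper : ∀ κ x v, m κ (x + (L : ℤ) • v) = m κ x)
    (κ : Fin (d + 1)) (y : Fin (d + 1) → ℤ) : contourSum L (axProjAt ρ L m) κ y = contourSum L m κ y := by
  rw [axProjAt_eq_sub_dz, contourSum_sub_apply, contourSum_dz_eq_zero_of_periodic (fun x v => treeGaugeAt_add_zsmul hL ρ hper x v), sub_zero]

/-! ## §2 The orthogonality theorem -/

/-- NOT IN PRINT; OUR BOOKKEEPING.  **A BOUNDED `L`-PERIODIC 1-FORM IS `(d*d)`-ORTHOGONAL TO EVERY MULTIPLIER-SLOT COLUMN OF A RELATIVE INVERSE WITH ZERO `mm` COLUMN MASS**: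
`RelInv G (bhK L) (axEc ρ L)` (in-block root), `G` spread, `Σ'_w G (L•w) (L•y′) (inr κ) (inr ν) = 0` for all `κ ν y′`, `m` bounded and `L`-periodic ⇒
`Σ'_u Σ_κ (curvAdj (curv m)) κ u·G u (L•y′) (inl κ) (inr ν) = 0`.  PROOF: `ward_pairing` at `W = idK` for the hard-axial representative `Π^ρ m` (bounded, zero on comb bonds, same `(d*d)`-image);
the source term is `idK`'s `(inl, inr)` block `= 0`; the multiplier term carries `𝒬_L (Π^ρ m) = 𝒬_L m`, constant in the block, against the vanishing `mm` column sums. -/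
theorem tsum_curvAdj_curv_mul_inr_col_eq_zero {L : ℕ} [NeZero L] {r : Fin (d + 1) → ℕ} (hr : r ∈ box (d + 1) L) {G : MKer (d + 1) (Fib d)}
    (hG : RelInv G (bhK L) (axEc (toSite r) L)) (hGs : Spr G)
    (hmm : ∀ (κ ν : Fin (d + 1)) (y' : Fin (d + 1) → ℤ), ∑' w : Fin (d + 1) → ℤ, G ((L : ℤ) • w) ((L : ℤ) • y') (Sum.inr κ) (Sum.inr ν) = 0)
    {m : Form1 (d + 1) ℝ} {B : ℝ} (hmB : ∀ κ u, |m κ u| ≤ B) (hper : ∀ κ x v, m κ (x + (L : ℤ) • v) = m κ x)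
    (ν : Fin (d + 1)) (y' : Fin (d + 1) → ℤ) :
    ∑' u, ∑ κ, curvAdj (curv m) κ u * G u ((L : ℤ) • y') (Sum.inl κ) (Sum.inr ν) = 0 := by
  classical
  have hL : 1 ≤ L := one_le_of_neZero L
  -- the hard-axial representative
  set m' : Form1 (d + 1) ℝ := axProjAt (toSite r) L m with hm'
  have hm'B : ∀ κ u, |m' κ u| ≤ B + 2 * ((((d + 1 : ℕ) : ℝ)) * L * B) := fun κ u => abs_axProjAt_le hL hr hmB κ u
  have hm'0 : ∀ κ u, IsCombBondAt (toSite r) L κ u → m' κ u = 0 := fun κ u h => axProjAt_eq_zero_of_isCombBond h m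
  have hdd : curvAdj (curv m) = curvAdj (curv m') := by
    rw [hm', axProjAt_eq_sub_dz, curvAdj_curv_sub_dz]
  -- the Ward pairing at `W = idK`
  have hW := ward_pairing hG hGs (spr_idK) hm'B hm'0 ((L : ℤ) • y') (Sum.inr ν)
  rw [comp_idK_right] at hW
  rw [hdd, hW]
  -- the source term vanishes: `idK`'s `(inl, inr)` entries are `0`
  have h1 : (fun u => ∑ κ, m' κ u * (idK : MKer (d + 1) (Fib d)) u ((L : ℤ) • y') (Sum.inl κ) (Sum.inr ν)) = fun _ => 0 := by
    funext u
    refine Finset.sum_eq_zero fun κ _ => ?_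
    rw [idK_apply, if_neg (fun h => Sum.inl_ne_inr h.2), mul_zero]
  rw [h1, tsum_zero, zero_add]
  -- the multiplier term: constant contour sums against zero column mass
  have h2 : ∀ y κ, contourSum L m' κ y = contourSum L m κ 0 := fun y κ => by
    rw [hm', contourSum_axProjAt hL (toSite r) hper]
    have := contourSum_add_coarse hper κ 0 y
    rwa [zero_add] at this
  simp only [h2]
  obtain ⟨C, δ, hδ, hGd⟩ := hGs
  have hsum : ∀ κ, Summable fun y : Fin (d + 1) → ℤ => G ((L : ℤ) • y) ((L : ℤ) • y') (Sum.inr κ) (Sum.inr ν) := by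
    intro κ
    refine Summable.of_norm_bounded ((summable_exp_shift' hδ y').mul_left C) (fun y => ?_)
    rw [Real.norm_eq_abs]
    refine (hGd _ _ _ _).trans ?_
    have hC : 0 ≤ C := by
      have := (abs_nonneg _).trans (hGd ((L : ℤ) • y') ((L : ℤ) • y') (Sum.inr ν) (Sum.inr ν))
      have h0 : l1 ((L : ℤ) • y' - (L : ℤ) • y') = 0 := by simp [B12Sec2to5.l1]
      rw [h0, mul_zero, Real.exp_zero, mul_one] at this
      exact this
    refine mul_le_mul_of_nonneg_left (Real.exp_le_exp.2 ?_) hC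
    have hl : l1 (y - y') ≤ l1 ((L : ℤ) • y - (L : ℤ) • y') := by
      unfold B12Sec2to5.l1
      refine Finset.sum_le_sum fun i _ => ?_
      have e : (((L : ℤ) • y - (L : ℤ) • y') i : ℝ) = (L : ℝ) * ((y - y') i : ℝ) := by
        push_cast [Pi.sub_apply, Pi.smul_apply, smul_eq_mul]; ring
      rw [e, abs_mul, Nat.abs_cast]
      have hL1 : (1 : ℝ) ≤ L := by exact_mod_cast hL
      nlinarith [abs_nonneg (((y - y') i : ℤ) : ℝ)]
    nlinarith
  rw [Summable.tsum_finsetSum (fun κ _ => (hsum κ).mul_left _)]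
  refine Finset.sum_eq_zero fun κ _ => ?_
  rw [tsum_mul_left, hmm κ ν y', mul_zero]

/-! ## §3 The co-dressed one-step resolvent and the edge potential -/

/-- [folklore] **THE `mm` COLUMN SUMS OF `G₀` VANISH** (an1's `colM_coDressKBmAt` — co-dressing does not touch the multiplier block — and gan24-leaf-14's `tsum_colM_KInvStep_pos`, BY NAME). -/
theorem tsum_inr_inr_coDressKBmAt_KInvStep_zero {Lc : ℕ} [NeZero Lc] (ρ : Fin (d + 1) → ℤ) (κ ν : Fin (d + 1)) (y' : Fin (d + 1) → ℤ) :
    ∑' w : Fin (d + 1) → ℤ, coDressKBmAt ρ Lc (KInvStep (d := d) Lc 0) ((Lc : ℤ) • w) ((Lc : ℤ) • y') (Sum.inr κ) (Sum.inr ν) = 0 := by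
  have e : ∀ w : Fin (d + 1) → ℤ, coDressKBmAt ρ Lc (KInvStep (d := d) Lc 0) ((Lc : ℤ) • w) ((Lc : ℤ) • y') (Sum.inr κ) (Sum.inr ν)
      = colM (KInvStep (d := d) Lc 0) Lc ν y' κ w := fun w => by
    rw [← colM_coDressKBmAt ρ Lc (KInvStep (d := d) Lc 0) ν y' κ w]; rfl
  simp only [e]
  exact tsum_colM_KInvStep_pos 0 ν y' κ

/-- NOT IN PRINT; OUR BOOKKEEPING.  **EVERY BOUNDED `Lc`-PERIODIC 1-FORM IS `(d*d)`-ORTHOGONAL TO EVERY ℋ-COLUMN OF `G₀ = coDressKBmAt (toSite r) Lc (KInvStep Lc 0)`** (in-block root; §2 with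
`relInv_coDressKBmAt_KInvStep_zero`, `spr_coDressKBmAt`, §3's column sums): `Σ'_u Σ_κ (curvAdj (curv m)) κ u·colH G₀ Lc ν y′ κ u = 0`. -/
theorem tsum_curvAdj_curv_mul_colH_eq_zero {Lc : ℕ} [NeZero Lc] {r : Fin (d + 1) → ℕ} (hr : r ∈ box (d + 1) Lc) {m : Form1 (d + 1) ℝ} {B : ℝ}
    (hmB : ∀ κ u, |m κ u| ≤ B) (hper : ∀ κ x v, m κ (x + (Lc : ℤ) • v) = m κ x) (ν : Fin (d + 1)) (y' : Fin (d + 1) → ℤ) :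
    ∑' u, ∑ κ, curvAdj (curv m) κ u * colH (coDressKBmAt (toSite r) Lc (KInvStep (d := d) Lc 0)) Lc ν y' κ u = 0 :=
  tsum_curvAdj_curv_mul_inr_col_eq_zero hr (relInv_coDressKBmAt_KInvStep_zero hr)
    (spr_coDressKBmAt (one_le_of_neZero Lc) hr
      (by obtain ⟨δ, C, hδ, -, h⟩ := OneStepKernelFamily.decays_KInvStep (d := d) (Lc := Lc) 0; exact ⟨C, δ, hδ, h⟩))
    (fun κ ν' y'' => tsum_inr_inr_coDressKBmAt_KInvStep_zero (toSite r) κ ν' y'') hmB hper ν y'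

/-- NOT IN PRINT; OUR BOOKKEEPING.  **THE EDGE POTENTIAL IS `(d*d)`-ORTHOGONAL TO EVERY ℋ-COLUMN OF `G₀`** (`a ≠ b`, `1 ≤ Lc`, in-block root, every slot `(ν, y′)`):
`Σ'_u Σ_κ (curvAdj (curv m̃_ab)) κ u·colH G₀ Lc ν y′ κ u = 0` — so the `g⁺(e)`-part of road-P2's (α⁺) read-vector drops out of the exit-class pairing, and
`⟨(d*d) m̃_ab, v_{α⁺}(e)⟩` is the block-RESTRICTED pairing alone (ENGINE E-leaf06-g46-1 (M2)). -/
theorem edgePotential_orthogonal_colH {Lc : ℕ} [NeZero Lc] (hLc : 1 ≤ Lc) {r : Fin (d + 1) → ℕ} (hr : r ∈ box (d + 1) Lc) {a b : Fin (d + 1)} (hab : a ≠ b)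
    (ν : Fin (d + 1)) (y' : Fin (d + 1) → ℤ) :
    ∑' u, ∑ κ, curvAdj (curv (fun β z =>
          ((Lc : ℝ) ^ 2)⁻¹ * ((((z + unitVec β) b % (Lc : ℤ) : ℤ)) : ℝ) * dz (fun w : Fin (d + 1) → ℤ => ((w a : ℤ) : ℝ)) β z
          - (Lc : ℝ)⁻¹ * (((z a % (Lc : ℤ) : ℤ)) : ℝ) * dz (fun w : Fin (d + 1) → ℤ => (((w b / (Lc : ℤ) : ℤ)) : ℝ)) β z)) κ u
        * colH (coDressKBmAt (toSite r) Lc (KInvStep (d := d) Lc 0)) Lc ν y' κ u = 0 :=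
  tsum_curvAdj_curv_mul_colH_eq_zero hr (B := 1) (fun κ u => abs_edgePotential_le_one hLc hab κ u)
    (fun κ x v => edgePotential_add_zsmul hLc hab κ x v) ν y'

end Summit.QuantumFields.BalabanUV.Beta.GAN24.EdgePotentialColumnOrthogonal

end
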